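import Summits.AtomisticToContinuum.FouriersLaw.Theorems.EmbeddedDrudeMourreDrudeDissolutionStubWickShellStaticSum
import Summits.AtomisticToContinuum.FouriersLaw.Theorems.EmbeddedDrudeMourreDrudeDissolutionStubWickShellStaticShift
import Summits.AtomisticToContinuum.FouriersLaw.Theorems.EmbeddedDrudeMourreDrudeDissolutionStubWickShellStaticParseval
import Summits.AtomisticToContinuum.FouriersLaw.Theorems.EmbeddedDrudeMourreDrudeDissolutionStubWickShellStaticWickCovariance
import Summits.AtomisticToContinuum.FouriersLaw.Theses.EmbeddedDrudeMourre
import Literature.MathematicalPhysics.KineticTheory.InfiniteChainInvariantStates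
import HarnessLib

/-!
# Stub K2 `stub_wickShellStatic`: the static zero-wavenumber form of Wick monomials (assembly)
(line `gram-pencil-harmonic-chaos`, crux `EmbeddedDrudeMourre.DrudeDissolution`,
item stmt-AtomisticToContinuum-12593; `--supports` file proving the REGISTERED stub K2; lead c11)

WHAT. For the shift-invariant Gibbs state `μ` of the harmonic chain `pinnedChain ω₂ 0 0 γ` at `T = 1` (whose
Stein/Isserlis structure is the hypothesis, = stub K1) and Wick monomials `:φ(f_0)⋯φ(f_{N−1}):`, `:φ(g_0)⋯:` of
degrees `N, M ∈ {2, 4}`: `Σ_y Cov(:Πφ(f_i):, :Πφ(g_i): ∘ τ_y)` converges and equals `Re ⟪wickVector f, wickVector g⟫`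
in the tree's chaos space.

HOW. `Cov = Σ_π Π_i C₁(f_i, τ_y g_{π i})` (Wick covariance formula `wickCovariance_of_stein` + shift covariance
`wick_comp_chainShift`); the lattice series is summed pattern by pattern on the zero-momentum shells
(`hasSum_prod_thermalCov_shift`, lattice Parseval `latticeParseval`); averaging over relabellings of `f`'s slots
(which does not change the sum) and `sum_sum_tsum_prod_thermalCov_shift` + `sum_powerset_inner_eq` identify the
value with `⟪wickVector f, wickVector g⟫`; different degrees are orthogonal on both sides.
-/

noncomputable section

namespace Summit.AtomisticToContinuum.FouriersLaw.Theorems.DrudeDissolution.GramPencilHarmonicChaos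

open MeasureTheory Filter Set Function Topology
open scoped InnerProductSpace ENNReal ComplexConjugate
open Literature.MathematicalPhysics.KineticTheory
open Literature.MathematicalPhysics.KineticTheory.HeatConduction
open HarmonicChaos ProbabilityTheory
open PinnedChainKinetic (𝕋 𝕋3 μ𝕋 μ𝕋3)
open scoped Literature.MathematicalPhysics.KineticTheory.HeatConduction.PinnedChainKinetic

/-! ## Continuity of Wick products -/

/-- Linear observables are continuous on `ChainConfig`. [folklore] -/
theorem continuous_linObs (f : TestFn) : Continuous (linObs f) := by
  unfold linObs Finsupp.sum
  refine Continuous.add (continuous_finsetSum _ fun x _ => ?_) (continuous_finsetSum _ fun x _ => ?_)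
  · exact continuous_const.mul (continuous_fst.comp (continuous_apply x))
  · exact continuous_const.mul (continuous_snd.comp (continuous_apply x))

/-- Wick products are continuous on `ChainConfig`. [folklore] -/
theorem continuous_wick (ω₂ T : ℝ) : ∀ (N : ℕ) (f : Fin N → TestFn), Continuous (wick ω₂ T N f) := by
  intro N
  induction N using Nat.twoStepInduction with
  | zero => intro f; exact continuous_const
  | one => intro f; exact continuous_linObs (f 0)
  | more N ih0 ih1 =>
    intro f
    show Continuous fun σ => linObs (f 0) σ * wick ω₂ T (N + 1) (Fin.tail f) σ -
        ∑ i : Fin (N + 1), thermalCov ω₂ T (f 0) (f i.succ) * wick ω₂ T N (Fin.removeNth i (Fin.tail f)) σ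
    exact ((continuous_linObs (f 0)).mul (ih1 _)).sub
      (continuous_finsetSum _ fun i _ => continuous_const.mul (ih0 _))

/-! ## Relabelling the slots of `f` -/

/-- Averaging over relabellings: `Σ_π Π_i C(f_{ρ i}, g_{π i}) = Σ_π Π_i C(f_i, g_{π i})`. [folklore] -/
theorem sum_perm_prod_relabel (C : TestFn → TestFn → ℝ) {N : ℕ} (f g : Fin N → TestFn) (ρ : Equiv.Perm (Fin N)) :
    ∑ π : Equiv.Perm (Fin N), ∏ i, C (f (ρ i)) (g (π i)) = ∑ π : Equiv.Perm (Fin N), ∏ i, C (f i) (g (π i)) := by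
  have hterm : ∀ π : Equiv.Perm (Fin N), ∏ i, C (f (ρ i)) (g (π i)) = ∏ j, C (f j) (g ((ρ.symm.trans π) j)) :=
    fun π => Fintype.prod_equiv ρ _ _ (fun i => by simp)
  simp_rw [hterm]
  let Ψ : Equiv.Perm (Fin N) ≃ Equiv.Perm (Fin N) :=
    { toFun := fun π => ρ.symm.trans π
      invFun := fun π => ρ.trans π
      left_inv := fun π => by ext x; simp
      right_inv := fun π => by ext x; simp }
  exact Fintype.sum_equiv Ψ _ _ (fun π => rfl)

/-! ## The covariance of shifted Wick products -/

/-- **Covariance of a Wick product with a shifted Wick product of the same degree** (`N ≥ 1`):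
`Cov(:Πφ(f_i):, :Πφ(g_i): ∘ τ_y) = Σ_π Π_i C_T(f_i, τ_y g_{π i})`. [cite: Janson1997, Thm 3.9] -/
theorem covariance_wick_shift (ω₂ T : ℝ) {μ : Measure ChainConfig} [IsProbabilityMeasure μ]
    (hint : ∀ (N M : ℕ) (f : Fin N → TestFn) (g : Fin M → TestFn),
      Integrable (fun σ : ChainConfig => wick ω₂ T N f σ * wick ω₂ T M g σ) μ)
    (hmean : ∀ (N : ℕ) (f : Fin (N + 1) → TestFn), ∫ σ, wick ω₂ T (N + 1) f σ ∂μ = 0)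
    (hprod : ∀ (N : ℕ) (f g : Fin N → TestFn), ∫ σ, wick ω₂ T N f σ * wick ω₂ T N g σ ∂μ =
      ∑ π : Equiv.Perm (Fin N), ∏ i, thermalCov ω₂ T (f i) (g (π i)))
    (N : ℕ) (f g : Fin (N + 1) → TestFn) (y : ℤ) :
    cov[wick ω₂ T (N + 1) f, wick ω₂ T (N + 1) g ∘ chainShift y; μ] =
      ∑ π : Equiv.Perm (Fin (N + 1)), ∏ i, thermalCov ω₂ T (f i)
        (Finsupp.mapDomain (fun x : ℤ => x + y) (g (π i)).1, Finsupp.mapDomain (fun x : ℤ => x + y) (g (π i)).2) := by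
  set g' : Fin (N + 1) → TestFn := fun i =>
    (Finsupp.mapDomain (fun x : ℤ => x + y) (g i).1, Finsupp.mapDomain (fun x : ℤ => x + y) (g i).2) with hg'
  have hshift : wick ω₂ T (N + 1) g ∘ chainShift y = wick ω₂ T (N + 1) g' := by
    funext σ
    exact wick_comp_chainShift ω₂ T y (N + 1) g σ
  have hmem : ∀ h : Fin (N + 1) → TestFn, MemLp (wick ω₂ T (N + 1) h) 2 μ := fun h => by
    rw [memLp_two_iff_integrable_sq (continuous_wick ω₂ T (N + 1) h).measurable.aestronglyMeasurable]
    simpa only [pow_two] using hint (N + 1) (N + 1) h h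
  rw [hshift, covariance_eq_sub (hmem f) (hmem g'), hmean N g', mul_zero, sub_zero]
  show ∫ σ, wick ω₂ T (N + 1) f σ * wick ω₂ T (N + 1) g' σ ∂μ = _
  rw [hprod (N + 1) f g']

/-- **Different degrees are uncorrelated**: `Cov(:Πφ(f_i):, :Πφ(g_j): ∘ τ_y) = 0` for `N ≠ M`, `M ≥ 1`.
[cite: Janson1997, Thm 3.9] -/
theorem covariance_wick_shift_of_ne (ω₂ T : ℝ) {μ : Measure ChainConfig} [IsProbabilityMeasure μ]
    (hint : ∀ (N M : ℕ) (f : Fin N → TestFn) (g : Fin M → TestFn),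
      Integrable (fun σ : ChainConfig => wick ω₂ T N f σ * wick ω₂ T M g σ) μ)
    (hmean : ∀ (N : ℕ) (f : Fin (N + 1) → TestFn), ∫ σ, wick ω₂ T (N + 1) f σ ∂μ = 0)
    (horth : ∀ (N M : ℕ) (f : Fin N → TestFn) (g : Fin M → TestFn), N ≠ M →
      ∫ σ, wick ω₂ T N f σ * wick ω₂ T M g σ ∂μ = 0)
    {N M : ℕ} (hNM : N ≠ M + 1) (f : Fin N → TestFn) (g : Fin (M + 1) → TestFn) (y : ℤ) :
    cov[wick ω₂ T N f, wick ω₂ T (M + 1) g ∘ chainShift y; μ] = 0 := by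
  set g' : Fin (M + 1) → TestFn := fun i =>
    (Finsupp.mapDomain (fun x : ℤ => x + y) (g i).1, Finsupp.mapDomain (fun x : ℤ => x + y) (g i).2) with hg'
  have hshift : wick ω₂ T (M + 1) g ∘ chainShift y = wick ω₂ T (M + 1) g' := by
    funext σ
    exact wick_comp_chainShift ω₂ T y (M + 1) g σ
  have hmem : ∀ (K : ℕ) (h : Fin K → TestFn), MemLp (wick ω₂ T K h) 2 μ := fun K h => by
    rw [memLp_two_iff_integrable_sq (continuous_wick ω₂ T K h).measurable.aestronglyMeasurable]
    simpa only [pow_two] using hint K K h h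
  rw [hshift, covariance_eq_sub (hmem N f) (hmem (M + 1) g'), hmean M g', mul_zero, sub_zero]
  show ∫ σ, wick ω₂ T N f σ * wick ω₂ T (M + 1) g' σ ∂μ = 0
  exact horth N (M + 1) f g' hNM

/-- **Chaos vectors of different degrees are orthogonal.** [cite: Janson1997, Thm 2.6] -/
theorem inner_wickVector_of_ne (ω₂ T : ℝ) {N M : ℕ} (hNM : N ≠ M) (f : Fin N → TestFn) (g : Fin M → TestFn) :
    ⟪wickVector ω₂ T f, wickVector ω₂ T g⟫_ℂ = 0 := by
  rw [lp.inner_eq_tsum]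
  refine (tsum_congr fun s => ?_).trans tsum_zero
  by_cases hs : s.cr + s.an = N
  · have hsM : s.cr + s.an ≠ M := fun h => hNM (hs.symm.trans h)
    rw [wickVector_apply_of_ne ω₂ T g hsM, inner_zero_right]
  · rw [wickVector_apply_of_ne ω₂ T f hs, inner_zero_left]

/-! ## The registered stub K2 -/

/-- **STUB K2 `stub_wickShellStatic` (line `gram-pencil-harmonic-chaos`).** Under the Stein/Isserlis structure of the
shift-invariant harmonic Gibbs states (the hypothesis, = stub K1), for the `T = 1` state `μ` of `pinnedChain ω₂ 0 0 γ` and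
Wick monomials of degrees `N, M ∈ {2, 4}`: the summed truncated correlation `Σ_y Cov(:Πφ(f_i):, :Πφ(g_i): ∘ τ_y)` converges
and equals `Re ⟪wickVector ω₂ 1 f, wickVector ω₂ 1 g⟫_ℂ` (sector by sector the zero-momentum shell integrals of the
symmetrised thermal-wave kernels). [cite: Janson1997, Thm 3.9; AokiLukkarinenSpohn2006, §3] -/
theorem stub_wickShellStatic :
    (∀ ω₂ γ T : ℝ, 0 < ω₂ → 0 < T → ∀ μ : MeasureTheory.Measure ChainConfig,
    (pinnedChain ω₂ 0 0 γ).IsChainGibbsMeasure T μ → IsShiftInvariant μ →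
      (∀ (N : ℕ) (f : Fin N → TestFn), MeasureTheory.Integrable (fun σ : ChainConfig => ∏ i, linObs (f i) σ) μ) ∧
      (∀ f₀ : TestFn, ∫ σ, linObs f₀ σ ∂μ = 0) ∧
      (∀ (N : ℕ) (f₀ : TestFn) (f : Fin (N + 1) → TestFn),
          ∫ σ, linObs f₀ σ * ∏ i, linObs (f i) σ ∂μ =
            ∑ i : Fin (N + 1), thermalCov ω₂ T f₀ (f i) * ∫ σ, ∏ j : Fin N, linObs (Fin.removeNth i f j) σ ∂μ)) →
  ∀ ω₂ γ : ℝ, 0 < ω₂ → ∀ μ : MeasureTheory.Measure ChainConfig,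
    (pinnedChain ω₂ 0 0 γ).IsChainGibbsMeasure 1 μ → IsShiftInvariant μ →
      ∀ (N M : ℕ) (f : Fin N → TestFn) (g : Fin M → TestFn), (N = 2 ∨ N = 4) → (M = 2 ∨ M = 4) →
        Summable (fun y : ℤ => cov[wick ω₂ 1 N f, wick ω₂ 1 M g ∘ chainShift y; μ]) ∧
        ∑' y : ℤ, cov[wick ω₂ 1 N f, wick ω₂ 1 M g ∘ chainShift y; μ] = (⟪wickVector ω₂ 1 f, wickVector ω₂ 1 g⟫_ℂ).re := by
  intro hK1 ω₂ γ hω μ hG hS N M f g hN hM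
  haveI : IsProbabilityMeasure μ := hG.isProbabilityMeasure
  obtain ⟨hI, hm0, hst⟩ := hK1 ω₂ γ 1 hω one_pos μ hG hS
  obtain ⟨hint, hmean, horth, hprod⟩ := wickCovariance_of_stein ω₂ 1 μ inferInstance hI hm0 hst
  obtain ⟨hP2, hP4⟩ := latticeParseval
  -- `M = M' + 1`
  obtain ⟨M', rfl⟩ : ∃ M', M = M' + 1 := by
    rcases hM with rfl | rfl
    · exact ⟨1, rfl⟩
    · exact ⟨3, rfl⟩
  by_cases hNM : N = M' + 1
  · subst hNM
    -- big-shell Parseval for `M' + 1` factors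
    have hP : ∀ B : Fin (M' + 1) → 𝕋 → ℂ, (∀ x, Continuous (B x)) →
        HasSum (fun y : ℤ => ∏ x, fourierCoeff (B x) y)
          (∫ κ : Shell (M' + 1) 0, ∏ x, B x ((κ : SectorConfig (M' + 1) 0).1 x) ∂shellMeasure (M' + 1) 0) := by
      rcases hM with h2 | h4
      · have h1 : M' = 1 := by omega
        subst h1
        exact bigShellParseval_of_two hP2
      · have h3 : M' = 3 := by omega
        subst h3
        exact bigShellParseval_of_four hP4
    -- the covariance, shift by shift
    have hcov : ∀ y : ℤ, cov[wick ω₂ 1 (M' + 1) f, wick ω₂ 1 (M' + 1) g ∘ chainShift y; μ] =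
        ∑ π : Equiv.Perm (Fin (M' + 1)), ∏ i, thermalCov ω₂ 1 (f i)
          (Finsupp.mapDomain (fun x : ℤ => x + y) (g (π i)).1, Finsupp.mapDomain (fun x : ℤ => x + y) (g (π i)).2) :=
      fun y => covariance_wick_shift ω₂ 1 hint hmean hprod M' f g y
    -- summability (in `ℂ`, then in `ℝ`)
    have hF1 : ∀ ρ π : Equiv.Perm (Fin (M' + 1)), Summable (fun y : ℤ => (((∏ i, thermalCov ω₂ 1 (f (ρ i))
        (Finsupp.mapDomain (fun x : ℤ => x + y) (g (π i)).1, Finsupp.mapDomain (fun x : ℤ => x + y) (g (π i)).2)) : ℝ) : ℂ)) :=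
      fun ρ π => (hasSum_prod_thermalCov_shift hω zero_le_one hP (f ∘ ρ) (g ∘ π)).summable
    have hSumC : Summable (fun y : ℤ => ((cov[wick ω₂ 1 (M' + 1) f, wick ω₂ 1 (M' + 1) g ∘ chainShift y; μ] : ℝ) : ℂ)) := by
      have h := summable_sum (s := (Finset.univ : Finset (Equiv.Perm (Fin (M' + 1)))))
        (fun π _ => hF1 (Equiv.refl _) π)
      refine h.congr fun y => ?_
      rw [hcov y]
      push_cast
      rfl
    have hSumR : Summable (fun y : ℤ => cov[wick ω₂ 1 (M' + 1) f, wick ω₂ 1 (M' + 1) g ∘ chainShift y; μ]) :=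
      Complex.summable_ofReal.1 hSumC
    refine ⟨hSumR, ?_⟩
    -- the value: average over relabellings of `f`'s slots
    set T1 : ℂ := ∑' y : ℤ, ((cov[wick ω₂ 1 (M' + 1) f, wick ω₂ 1 (M' + 1) g ∘ chainShift y; μ] : ℝ) : ℂ) with hT1
    have hρ : ∀ ρ : Equiv.Perm (Fin (M' + 1)),
        ∑ π : Equiv.Perm (Fin (M' + 1)), ∑' y : ℤ, (((∏ i, thermalCov ω₂ 1 (f (ρ i))
          (Finsupp.mapDomain (fun x : ℤ => x + y) (g (π i)).1, Finsupp.mapDomain (fun x : ℤ => x + y) (g (π i)).2)) : ℝ) : ℂ) =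
        T1 := by
      intro ρ
      rw [← Summable.tsum_finsetSum (fun π _ => hF1 ρ π), hT1]
      refine tsum_congr fun y => ?_
      rw [hcov y]
      push_cast
      have h := sum_perm_prod_relabel (fun a b => thermalCov ω₂ 1 a b) f
        (fun i => (Finsupp.mapDomain (fun x : ℤ => x + y) (g i).1, Finsupp.mapDomain (fun x : ℤ => x + y) (g i).2)) ρ
      exact_mod_cast h
    have hF23 := sum_sum_tsum_prod_thermalCov_shift hω zero_le_one (Nat.succ_ne_zero M') hP f g
    rw [sum_powerset_inner_eq (Nat.succ_ne_zero M') f g, Finset.sum_congr rfl (fun ρ _ => hρ ρ), Finset.sum_const,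
      Finset.card_univ, Fintype.card_perm, Fintype.card_fin, nsmul_eq_mul] at hF23
    have hfact : ((M' + 1).factorial : ℂ) ≠ 0 := by exact_mod_cast (Nat.factorial_pos _).ne'
    have hT1eq : T1 = ⟪wickVector ω₂ 1 f, wickVector ω₂ 1 g⟫_ℂ := mul_left_cancel₀ hfact hF23
    have hre : ((∑' y : ℤ, cov[wick ω₂ 1 (M' + 1) f, wick ω₂ 1 (M' + 1) g ∘ chainShift y; μ] : ℝ) : ℂ) = T1 := by
      rw [hT1, Complex.ofReal_tsum]
    rw [← hT1eq, ← hre, Complex.ofReal_re]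
  · -- different degrees: both sides vanish
    have hcov : ∀ y : ℤ, cov[wick ω₂ 1 N f, wick ω₂ 1 (M' + 1) g ∘ chainShift y; μ] = 0 :=
      fun y => covariance_wick_shift_of_ne ω₂ 1 hint hmean horth hNM f g y
    simp_rw [hcov]
    refine ⟨summable_zero, ?_⟩
    rw [tsum_zero, inner_wickVector_of_ne ω₂ 1 hNM f g, Complex.zero_re]

end Summit.AtomisticToContinuum.FouriersLaw.Theorems.DrudeDissolution.GramPencilHarmonicChaos

end
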